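import Mathlib
import Summits.CriticalPhenomena.CardyFormulaZ2.Theorems.CardySelfRefinementGradientComparabilityOfMonotoneLine
import Summits.CriticalPhenomena.CardyFormulaZ2.Theorems.CardySelfRefinementGradientComparabilityStubLevelSetTransportPointwise
import HarnessLib

/-!
# Crux `GradientComparability` (stmt-CriticalPhenomena-10269), line `monotone-product-coordinates`:
# the composition `GradientComparability_of_monotoneLineW` (pointwise corner BET)

Route `CardySelfRefinement`, sub-problem `CriticalPhenomena/CardyFormulaZ2`; vocabulary (`P`, `Dρ`,
`Dc`, `PathOK`, `M`, `ax`, `tb`, …) from `CardySelfRefinementDefs` (definitionally the route's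
`let`-chain; `gradientComparability_iff` is `Iff.rfl`).

Twin of the landed `GradientComparability_of_monotoneLine` (`…OfMonotoneLine`) in which the fourth
hypothesis, the registered corner BET (R) (`Dρ ≠ 0` and `Dc/Dρ` `Θ`-Lipschitz in `ρ` between any two
band points of the corner strip), is replaced by its WEAKEST CONSUMED FORM, the pointwise corner
BET

  (W)  at every band point `(ρ, c)` of the strip `[1-2δ, 1] × [0, 1]`: `Dρ ≠ 0`, and every
       within-`[0,1]` derivative `S'` of `r ↦ Dc(r,c)/Dρ(r,c)` at `ρ` has `|S'| ≤ Θ`,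

mesh-uniformly on each level band.  The level-set comparability now comes from
`stub_levelSetTransport_of_pointwiseCornerBet` (`…StubLevelSetTransportPointwise`); the bulk and
corner charts (`monotoneLine_charts`), their overlap along the path (`MonotoneLine.overlap`) and
clause (ii) at the Bernoulli endpoint `γ 1 = (0,½)` (`divergesAt_zero_half`) are exactly as in
`GradientComparability_of_monotoneLine`.
-/

noncomputable section

namespace Summit.CriticalPhenomena.CardyFormulaZ2.Theorems.CardySelfRefinement

open scoped Topology
open Filter Set MeasureTheory
open Literature.Probability.LatticeModels Literature.Probability.Percolation
open Literature.Probability.Percolation.QuadCrossing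
open Summit.CriticalPhenomena.CardyFormulaZ2.Theses.CardySelfRefinement

-- adapted from `GradientComparability_of_monotoneLine`
-- (…Theorems/CardySelfRefinementGradientComparabilityOfMonotoneLine.lean:142-164)
/-- **The line `monotone-product-coordinates` with the pointwise corner BET (registered composition
helper).**  The monotone product representation (`stub_monotoneRep`), the first-order slope bounds
(`stub_slopeBounds`), THE BET (`stub_bet`), the POINTWISE corner BET (W), the Kesten patch at the
independent corner (`stub_cornerPatch`) and the Kesten window on the independent slice `ρ = 0`
(`stub_windowAtRhoZero`), their signatures inlined verbatim and in this order, imply the crux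
`GradientComparability` BY NAME: the slope bounds are `hSB hMR`, the level-set comparability is
`stub_levelSetTransport_of_pointwiseCornerBet hBET hCBW hCP`, `monotoneLine_charts` supplies the
bulk and corner charts, `MonotoneLine.overlap` glues them into clause (i), and clause (ii) follows
from clause (i) at the endpoint `γ 1 = (0,½)` and `divergesAt_zero_half`. -/
theorem GradientComparability_of_monotoneLineW :
    (∀ k : ℕ, ∀ ρ ∈ Set.Icc (0 : ℝ) 1, ∀ c ∈ Set.Icc (0 : ℝ) 1, M k ρ c = (prodBernoulli (fun i :
    Site 2 × Fin 2 × Fin 3 => if i.2.2 = 0 then (if ax k (i.1, i.2.1) then half else Set.projIcc (0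
    : ℝ) 1 zero_le_one c) else if i.2.2 = 1 then Set.projIcc (0 : ℝ) 1 zero_le_one (ρ / 2) else
    Set.projIcc (0 : ℝ) 1 zero_le_one ((2 - 2 * ρ) / (2 - ρ)))).map (fun S : Set (Site 2 × Fin 2 ×
    Fin 3) => ({e | ∃ (v : Site 2) (d : Fin 2), e = s(v, v + (if d = 0 then ![1, 0] else ![0, 1])) ∧
    (if ax k (v, d) then ((tb k (v, d), d, (1 : Fin 3)) ∈ S ∨ ((tb k (v, d), d, (2 : Fin 3)) ∈ S ∧
    (v, d, (0 : Fin 3)) ∈ S)) else (v, d, (0 : Fin 3)) ∈ S)} : BondConfig (Site 2)))) → ((∀ k : ℕ, ∀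
    ρ ∈ Set.Icc (0 : ℝ) 1, ∀ c ∈ Set.Icc (0 : ℝ) 1, M k ρ c = (prodBernoulli (fun i : Site 2 × Fin 2
    × Fin 3 => if i.2.2 = 0 then (if ax k (i.1, i.2.1) then half else Set.projIcc (0 : ℝ) 1
    zero_le_one c) else if i.2.2 = 1 then Set.projIcc (0 : ℝ) 1 zero_le_one (ρ / 2) else Set.projIcc
    (0 : ℝ) 1 zero_le_one ((2 - 2 * ρ) / (2 - ρ)))).map (fun S : Set (Site 2 × Fin 2 × Fin 3) => ({e
    | ∃ (v : Site 2) (d : Fin 2), e = s(v, v + (if d = 0 then ![1, 0] else ![0, 1])) ∧ (if ax k (v,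
    d) then ((tb k (v, d), d, (1 : Fin 3)) ∈ S ∨ ((tb k (v, d), d, (2 : Fin 3)) ∈ S ∧ (v, d, (0 :
    Fin 3)) ∈ S)) else (v, d, (0 : Fin 3)) ∈ S)} : BondConfig (Site 2)))) → ∀ k : ℕ, k = 2 ∨ k = 3 →
    ∀ γ : unitInterval → ℝ × ℝ, PathOK k γ → ∀ (m : ℕ) (F : Fin m → Quad (Set.univ : Set ℂ)), 0 < m
    → (∀ δ : ℝ, 0 < δ → δ ≤ 1 / 2 → ∃ C η₁ : ℝ, 0 < η₁ ∧ ∀ η ∈ Set.Ioo 0 η₁, ∀ s : unitInterval, (γ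
    s).1 ≤ 1 - δ → |Dρ k m F η (γ s)| ≤ C * Dc k m F η (γ s)) ∧ (∃ δ : ℝ, 0 < δ ∧ δ ≤ 1 / 4 ∧ ∀ vlo
    vhi : ℝ, 0 < vlo → vlo < vhi → vhi < 1 → ∃ C η₁ : ℝ, 0 < η₁ ∧ ∀ η ∈ Set.Ioo 0 η₁, ∀ ρ ∈ Set.Icc
    (1 - 2 * δ) 1, ∀ c ∈ Set.Icc (0 : ℝ) 1, P k m F η ρ c ∈ Set.Icc vlo vhi → |Dc k m F η (ρ, c)| ≤
    C * |Dρ k m F η (ρ, c)|)) → (∀ k : ℕ, k = 2 ∨ k = 3 → ∀ γ : unitInterval → ℝ × ℝ, PathOK k γ → ∀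
    (m : ℕ) (F : Fin m → Quad (Set.univ : Set ℂ)), 0 < m → ∀ δ : ℝ, 0 < δ → δ ≤ 1 / 2 → ∀ vlo vhi :
    ℝ, 0 < vlo → vlo < vhi → vhi < 1 → ∃ Θ η₁ : ℝ, 0 ≤ Θ ∧ 0 < η₁ ∧ ∀ η ∈ Set.Ioo 0 η₁, ∀ ρ ∈
    Set.Icc (0 : ℝ) (1 - δ), ∀ c ∈ Set.Icc (0 : ℝ) 1, ∀ c' ∈ Set.Icc (0 : ℝ) 1, P k m F η ρ c ∈
    Set.Icc vlo vhi → P k m F η ρ c' ∈ Set.Icc vlo vhi → |Dρ k m F η (ρ, c) / Dc k m F η (ρ, c) - Dρ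
    k m F η (ρ, c') / Dc k m F η (ρ, c')| ≤ Θ * |c - c'|) → (∀ k : ℕ, k = 2 ∨ k = 3 → ∀ γ :
    unitInterval → ℝ × ℝ, PathOK k γ → ∀ (m : ℕ) (F : Fin m → Quad (Set.univ : Set ℂ)), 0 < m → ∃ δ
    : ℝ, 0 < δ ∧ δ ≤ 1 / 4 ∧ ∀ vlo vhi : ℝ, 0 < vlo → vlo < vhi → vhi < 1 → ∃ Θ η₁ : ℝ, 0 ≤ Θ ∧ 0 <
    η₁ ∧ ∀ η ∈ Set.Ioo 0 η₁, ∀ c ∈ Set.Icc (0 : ℝ) 1, ∀ ρ ∈ Set.Icc (1 - 2 * δ) 1, P k m F η ρ c ∈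
    Set.Icc vlo vhi → Dρ k m F η (ρ, c) ≠ 0 ∧ ∀ S' : ℝ, HasDerivWithinAt (fun r => Dc k m F η (r, c)
    / Dρ k m F η (r, c)) S' (Set.Icc 0 1) ρ → |S'| ≤ Θ) → (∀ k : ℕ, k = 2 ∨ k = 3 → ∀ (m : ℕ) (F :
    Fin m → Quad (Set.univ : Set ℂ)), 0 < m → ∀ vlo vhi : ℝ, 0 < vlo → vlo < vhi → vhi < 1 → ∃ Λ η₁
    : ℝ, 0 < η₁ ∧ ∀ η ∈ Set.Ioo 0 η₁, ∀ q ∈ Set.Icc (0 : ℝ) 1 ×ˢ Set.Icc (0 : ℝ) 1, ∀ q' ∈ Set.Icc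
    (0 : ℝ) 1 ×ˢ Set.Icc (0 : ℝ) 1, (q.1 = 1 ∨ q.2 = 0) → (q'.1 = 1 ∨ q'.2 = 0) → P k m F η q.1 q.2
    ∈ Set.Icc vlo vhi → P k m F η q'.1 q'.2 ∈ Set.Icc vlo vhi → |Dρ k m F η q| ≤ Λ * |Dρ k m F η
    q'|) → (∀ k : ℕ, k = 2 ∨ k = 3 → ∀ (m : ℕ) (F : Fin m → Quad (Set.univ : Set ℂ)), 0 < m → ∀ vlo
    vhi : ℝ, 0 < vlo → vlo < vhi → vhi < 1 → ∃ Λ η₁ : ℝ, 0 < η₁ ∧ ∀ η ∈ Set.Ioo 0 η₁, ∀ c ∈ Set.Icc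
    (0 : ℝ) 1, ∀ c' ∈ Set.Icc (0 : ℝ) 1, P k m F η 0 c ∈ Set.Icc vlo vhi → P k m F η 0 c' ∈ Set.Icc
    vlo vhi → Dc k m F η (0, c) ≤ Λ * Dc k m F η (0, c')) → GradientComparability := by
  intro hMR hSB hBET hCBW hCP hK0
  rw [gradientComparability_iff]
  intro k hk γ hγ m F hm
  obtain ⟨δ, Λ, η₀, hδ, hδ', hη₀, hch⟩ :=
    monotoneLine_charts (hSB hMR) (stub_levelSetTransport_of_pointwiseCornerBet hBET hCBW hCP) hCP
      hK0 k hk γ hγ m F hm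
  set L : ℝ := max Λ 1 * max Λ 1 with hL
  have hcomp : ∀ s s' : unitInterval, ∀ η ∈ Set.Ioo 0 η₀,
      |Dρ k m F η (γ s)| + |Dc k m F η (γ s)| ≤ L * (|Dρ k m F η (γ s')| + |Dc k m F η (γ s')|) :=
    fun s s' η hη =>
      MonotoneLine.overlap hγ.1 (by rw [hγ.2.1]) (by rw [hγ.2.2.1])
        (G := fun s => |Dρ k m F η (γ s)| + |Dc k m F η (γ s)|)
        (fun _ => add_nonneg (abs_nonneg _) (abs_nonneg _)) hδ hδ' (fun a b => hch a b η hη) s s'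
  refine ⟨L, η₀, hη₀, hcomp, fun N => ?_⟩
  obtain ⟨η₁, hη₁, hdiv⟩ := divergesAt_zero_half k hk m F hm (L * max N 0)
  refine ⟨min η₀ η₁, lt_min hη₀ hη₁, fun η hη s => ?_⟩
  have hend : γ 1 = ((0 : ℝ), (1 / 2 : ℝ)) := hγ.2.2.1
  have h1 := hcomp 1 s η ⟨hη.1, lt_of_lt_of_le hη.2 (min_le_left _ _)⟩
  rw [hend] at h1
  have h2 := hdiv η ⟨hη.1, lt_of_lt_of_le hη.2 (min_le_right _ _)⟩
  have hLpos : 0 < L := by positivity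
  exact (le_max_left N 0).trans (le_of_mul_le_mul_left (h2.trans h1) hLpos)

end Summit.CriticalPhenomena.CardyFormulaZ2.Theorems.CardySelfRefinement

end
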